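import Summits.AtomisticToContinuum.Crystallization.Theses.GappedShellCensus
import Literature.Probability.Process.LocalRubberCompact
import Literature.Probability.Process.LocalRubberHardCore
import Literature.MathematicalPhysics.StatisticalMechanics.LocalMatchingCompactness

/-!
# Sketch (crux-ideate r1, ideator 1) — `GappedShellCensus.CleanLimitExtractionR`
# (stmt-AtomisticToContinuum-18072)

First lemmas of the two crux idea cards of this seat, over existing declarations only
(route file + `Literature.Probability.Process.LocalRubber*`).

* Card `rationing-splice` (Line A): the repaired antecedent list collapses onto the ALPHABET-FREE
  rationing statement `GappedRationing` (the splice point of the complete pre-repair workfile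
  `Cruxes/CleanLimitExtraction/SketchIdeator2.lean`, whose `cleanLimitExtraction_via_hull :
  GappedRationing → RadialDefectsVanish → CleanLocalLimit` is sorry-free):
  `gappedRationing_of_trichotomy : ShellTrichotomy → TornFree → FiveFoldRationingR → GappedRationing`
  — PROVED below from the degree dictionary `shellDegree_eq_commonNbrs` (shell-degree of `a⁻¹(v-y)`
  in the rescaled shell = common-neighbour count of the bond `(y,v)`), itself PROVED.
* Card `semicontinuous-census` (Line B): only an INJECTION crosses the last limit —
  `commonNbrs_le_transfer` (one-way matched, limit-free; stated, to be proved by the line) — and the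
  typing by `ShellTrichotomy` happens in the final configuration (`fccHcpShell_of_fourRegular`,
  PROVED below), so no typing-closedness / compact-`O(3)` argument is needed.
-/

noncomputable section

open Filter Topology Set

namespace Summit.AtomisticToContinuum.Crystallization.Cruxes.CleanLimitExtractionR.Ideator1

open Literature.Probability.Process Literature.MathematicalPhysics.StatisticalMechanics
  Literature.Geometry.DiscreteGeometry
open Summit.AtomisticToContinuum.Crystallization.Theses.GappedShellCensus

/-- Euclidean 3-space. -/
abbrev E3 := EuclideanSpace ℝ (Fin 3)

/-- The crux, definitionally. -/
example : CleanLimitExtractionR ↔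
    (RadialDefectsVanish → ShellTrichotomy → TornFree → FiveFoldRationingR → CleanLocalLimit) :=
  Iff.rfl

/-! ## The route's inlined site predicates, named (verbatim clauses) -/

/-- GAPPED-TWELVE at scale `a` (the route's clause for a site `y` of `Y`). -/
def GappedTwelve (a : ℝ) (Y : Set E3) (y : E3) : Prop :=
  {w ∈ Y | w ≠ y ∧ dist y w ≤ a * (1 + 1 / 50)}.ncard = 12 ∧
    ∀ w ∈ Y, w ≠ y → a * (1 - 1 / 50) ≤ dist y w ∧
      (dist y w ≤ a * (1 + 1 / 50) ∨ a * (63 / 50) ≤ dist y w)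

/-- The rescaled bond shell of `y` is `1/5`-close to fcc or hcp (the route's typing clause). -/
def FccHcpShell (a : ℝ) (Y : Set E3) (y : E3) : Prop :=
  ∃ T : Finset E3, (↑T : Set E3) = (fun w => a⁻¹ • (w - y)) '' {w ∈ Y | w ≠ y ∧ dist y w ≤ a * (1 + 1 / 50)} ∧
    (ShellCloseTo (1 / 5) T fccKissingPattern ∨ ShellCloseTo (1 / 5) T hcpKissingPattern)

/-- The common bonded neighbours of the bond `(y, v)` (the set counted by `TornFree` and
`FiveFoldRationingR`). -/
def CommonNbrs (a : ℝ) (Y : Set E3) (y v : E3) : Set E3 :=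
  {w ∈ Y | w ≠ y ∧ w ≠ v ∧ dist y w ≤ a * (1 + 1 / 50) ∧ dist v w ≤ a * (1 + 1 / 50)}

/-- The ALPHABET-FREE rationing — the splice point: an all-gapped-twelve non-empty `Y` has
fcc/hcp-clean balls of every radius.  (Verbatim the `GappedRationing` of the pre-repair workfile
`Cruxes/CleanLimitExtraction/SketchIdeator2.lean`, where
`cleanLimitExtraction_via_hull : GappedRationing → RadialDefectsVanish → CleanLocalLimit` is PROVED.) -/
def GappedRationing : Prop :=
  ∀ (Y : Set E3) (a : ℝ), 0 < a → Y.Nonempty → (∀ y ∈ Y, GappedTwelve a Y y) →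
    ∀ R : ℝ, ∃ c ∈ Y, ∀ y ∈ Y, dist y c ≤ R → FccHcpShell a Y y

/-- The crux from the two factors (trivial logic): the hull extraction of the pre-repair workfile
and the new splice lemma. PROVED. -/
theorem cleanLimitExtractionR_of_splice
    (hHull : GappedRationing → RadialDefectsVanish → CleanLocalLimit)
    (hSplice : ShellTrichotomy → TornFree → FiveFoldRationingR → GappedRationing) :
    CleanLimitExtractionR :=
  fun hRDV hST hTF hFFR => hHull (hSplice hST hTF hFFR) hRDV

/-! ## Line A — the degree dictionary and the splice lemma (all PROVED) -/

/-- The rescaling `w ↦ a⁻¹ • (w - y)` is injective. -/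
theorem rescale_injective {a : ℝ} (ha : 0 < a) (y : E3) :
    Function.Injective fun w : E3 => a⁻¹ • (w - y) := fun u v huv => by
  have h := smul_right_injective E3 (inv_ne_zero ha.ne') huv
  exact sub_left_injective h

/-- Distances rescale: `dist (a⁻¹(v-y)) (a⁻¹(w-y)) = a⁻¹ dist v w`. -/
theorem dist_rescale {a : ℝ} (ha : 0 < a) (y v w : E3) :
    dist (a⁻¹ • (v - y)) (a⁻¹ • (w - y)) = a⁻¹ * dist v w := by
  rw [dist_smul₀, norm_inv, Real.norm_of_nonneg ha.le, dist_sub_right]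

/-- THE RESCALED SHELL satisfies the three typing hypotheses of `ShellTrichotomy` at every site of
an all-gapped-twelve configuration (twelve points; radii in `[0.98, 1.02]`; mutual distances
admissible because every shell point is itself a gapped-twelve site). PROVED. -/
theorem rescaledShell_hyps {Y : Set E3} {a : ℝ} (ha : 0 < a)
    (hgood : ∀ y ∈ Y, GappedTwelve a Y y) {y : E3} (hy : y ∈ Y) :
    ∃ T : Finset E3,
      (↑T : Set E3) = (fun w => a⁻¹ • (w - y)) '' {w ∈ Y | w ≠ y ∧ dist y w ≤ a * (1 + 1 / 50)} ∧
      T.card = 12 ∧ (∀ v ∈ T, 1 - 1 / 50 ≤ ‖v‖ ∧ ‖v‖ ≤ 1 + 1 / 50) ∧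
      (∀ v ∈ T, ∀ w ∈ T, v ≠ w → 1 - 1 / 50 ≤ dist v w ∧ (dist v w ≤ 1 + 1 / 50 ∨ 63 / 50 ≤ dist v w)) := by
  obtain ⟨hcount, hrad⟩ := hgood y hy
  have hfin : {w ∈ Y | w ≠ y ∧ dist y w ≤ a * (1 + 1 / 50)}.Finite :=
    Set.finite_of_ncard_ne_zero (by rw [hcount]; norm_num)
  have hfinT := hfin.image (fun w => a⁻¹ • (w - y))
  refine ⟨hfinT.toFinset, hfinT.coe_toFinset, ?_, ?_, ?_⟩
  · rw [← Set.ncard_coe_finset, hfinT.coe_toFinset, Set.ncard_image_of_injective _ (rescale_injective ha y),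
      hcount]
  · intro v hv
    rw [Set.Finite.mem_toFinset] at hv
    obtain ⟨w, ⟨hw, hwy, hd⟩, rfl⟩ := hv
    have hlo := (hrad w hw hwy).1
    rw [norm_smul, norm_inv, Real.norm_of_nonneg ha.le, ← dist_eq_norm, dist_comm]
    constructor
    · rw [le_inv_mul_iff₀ ha]; linarith
    · rw [inv_mul_le_iff₀ ha]; linarith
  · intro v hv v' hv' hvv'
    rw [Set.Finite.mem_toFinset] at hv hv'
    obtain ⟨w, ⟨hw, hwy, hd⟩, rfl⟩ := hv
    obtain ⟨w', ⟨hw', hw'y, hd'⟩, rfl⟩ := hv'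
    have hww' : w ≠ w' := fun h => hvv' (by rw [h])
    obtain ⟨h1, h2⟩ := (hgood w hw).2 w' hw' (Ne.symm hww')
    rw [dist_rescale ha]
    refine ⟨by rw [le_inv_mul_iff₀ ha]; linarith, ?_⟩
    rcases h2 with h | h
    · left; rw [inv_mul_le_iff₀ ha]; linarith
    · right; rw [le_inv_mul_iff₀ ha]; linarith

/-- THE DEGREE DICTIONARY (the crux's named bookkeeping step): for a bond `(y, v)`, the shell-degree
of `a⁻¹(v - y)` inside the rescaled shell `T` of `y` equals the number of common bonded neighbours
of `y` and `v`. PROVED. -/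
theorem shellDegree_eq_commonNbrs {Y : Set E3} {a : ℝ} (ha : 0 < a) {y : E3}
    {T : Finset E3}
    (hT : (↑T : Set E3) = (fun w => a⁻¹ • (w - y)) '' {w ∈ Y | w ≠ y ∧ dist y w ≤ a * (1 + 1 / 50)})
    {v : E3} (hv : v ∈ Y) (hvy : v ≠ y) (hdv : dist y v ≤ a * (1 + 1 / 50)) :
    (T.filter fun w' => w' ≠ a⁻¹ • (v - y) ∧ dist (a⁻¹ • (v - y)) w' ≤ 1 + 1 / 50).card =
      (CommonNbrs a Y y v).ncard := by
  classical
  have hfinj : Function.Injective (fun w : E3 => a⁻¹ • (w - y)) := rescale_injective ha y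
  -- the filtered Finset, as a set, is the image of the common-neighbour set
  have key : (↑(T.filter fun w' => w' ≠ a⁻¹ • (v - y) ∧ dist (a⁻¹ • (v - y)) w' ≤ 1 + 1 / 50) : Set E3) =
      (fun w : E3 => a⁻¹ • (w - y)) '' CommonNbrs a Y y v := by
    rw [Finset.coe_filter]
    ext w'
    constructor
    · rintro ⟨hw'T, hne, hdist⟩
      have hw'T' : w' ∈ (fun w : E3 => a⁻¹ • (w - y)) '' {w ∈ Y | w ≠ y ∧ dist y w ≤ a * (1 + 1 / 50)} := by
        rw [← hT]; exact hw'T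
      simp only [Set.mem_image, Set.mem_setOf_eq] at hw'T'
      obtain ⟨w, ⟨hw, hwy, hdw⟩, rfl⟩ := hw'T'
      refine ⟨w, ⟨hw, hwy, ?_, hdw, ?_⟩, rfl⟩
      · intro h; apply hne; rw [h]
      · rw [dist_rescale ha, inv_mul_le_iff₀ ha] at hdist
        linarith
    · rintro ⟨w, ⟨hw, hwy, hwv, hdw, hdvw⟩, rfl⟩
      refine ⟨?_, ?_, ?_⟩
      · show a⁻¹ • (w - y) ∈ (↑T : Set E3)
        rw [hT]
        exact ⟨w, ⟨hw, hwy, hdw⟩, rfl⟩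
      · intro h; exact hwv (hfinj h)
      · show dist (a⁻¹ • (v - y)) (a⁻¹ • (w - y)) ≤ 1 + 1 / 50
        rw [dist_rescale ha, inv_mul_le_iff₀ ha]
        linarith
  rw [← Set.ncard_coe_finset, key, Set.ncard_image_of_injective _ hfinj]

/-- TYPING IN SITU: at a site all of whose bonds have EXACTLY four common neighbours,
`ShellTrichotomy` leaves only branch (A): the rescaled shell is `1/5`-close to fcc or hcp.
(Branches (B) `≥ 5` and (C) `≤ 3` are read through the degree dictionary.) PROVED. -/
theorem fccHcpShell_of_fourRegular (hST : ShellTrichotomy) {Y : Set E3} {a : ℝ} (ha : 0 < a)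
    (hgood : ∀ y ∈ Y, GappedTwelve a Y y) {y : E3} (hy : y ∈ Y)
    (h4 : ∀ v ∈ Y, v ≠ y → dist y v ≤ a * (1 + 1 / 50) → (CommonNbrs a Y y v).ncard = 4) :
    FccHcpShell a Y y := by
  classical
  obtain ⟨T, hT, hcard, hnorm, hpair⟩ := rescaledShell_hyps ha hgood hy
  refine ⟨T, hT, ?_⟩
  -- a shell point `v' ∈ T` comes from a bond `(y, v)`
  have hpre : ∀ v' ∈ T, ∃ v ∈ Y, v ≠ y ∧ dist y v ≤ a * (1 + 1 / 50) ∧ v' = a⁻¹ • (v - y) := by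
    intro v' hv'
    have hv'T : v' ∈ (↑T : Set E3) := hv'
    rw [hT] at hv'T
    obtain ⟨v, ⟨hv, hvy, hdv⟩, rfl⟩ := hv'T
    exact ⟨v, hv, hvy, hdv, rfl⟩
  rcases hST T hcard hnorm hpair with hA | hA | hB | hC
  · exact Or.inl hA
  · exact Or.inr hA
  · exfalso
    obtain ⟨v', hv', h5⟩ := hB
    obtain ⟨v, hv, hvy, hdv, rfl⟩ := hpre v' hv'
    rw [shellDegree_eq_commonNbrs ha hT hv hvy hdv, h4 v hv hvy hdv] at h5
    omega
  · exfalso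
    obtain ⟨v', hv', h3⟩ := hC
    obtain ⟨v, hv, hvy, hdv, rfl⟩ := hpre v' hv'
    rw [shellDegree_eq_commonNbrs ha hT hv hvy hdv, h4 v hv hvy hdv] at h3
    omega

/-- **THE SPLICE LEMMA (first lemma of card `rationing-splice`)**: the repaired antecedents give
the alphabet-free rationing — `TornFree` bounds every common-neighbour count below by `4`,
`FiveFoldRationingR` bounds it above by `4` on balls of every radius, and in those balls the
trichotomy types every shell fcc/hcp. PROVED. -/
theorem gappedRationing_of_trichotomy (hST : ShellTrichotomy) (hTF : TornFree)
    (hFFR : FiveFoldRationingR) : GappedRationing := by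
  intro Y a ha hne hgood R
  have htf : ∀ y ∈ Y, ∀ v ∈ Y, v ≠ y → dist y v ≤ a * (1 + 1 / 50) → 4 ≤ (CommonNbrs a Y y v).ncard :=
    hTF Y a ha (fun y hy => hgood y hy)
  obtain ⟨c, hc, hcR⟩ := hFFR Y a ha hne (fun y hy => hgood y hy) htf R
  refine ⟨c, hc, fun y hy hyc => fccHcpShell_of_fourRegular hST ha hgood hy fun v hv hvy hdv => ?_⟩
  exact le_antisymm (hcR y hy hyc v hv hvy hdv) (htf y hy v hv hvy hdv)

/-- Card `rationing-splice`, assembled modulo the hull extraction of the pre-repair workfile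
(`cleanLimitExtraction_via_hull`, sorry-free there; to be re-landed under `Theorems/`). PROVED. -/
theorem cleanLimitExtractionR_of_hull
    (hHull : GappedRationing → RadialDefectsVanish → CleanLocalLimit) : CleanLimitExtractionR :=
  cleanLimitExtractionR_of_splice hHull gappedRationing_of_trichotomy

/-! ## Line B — only an injection crosses the last limit -/

/-- **FIRST LEMMA of card `semicontinuous-census`** (finite, limit-free, ONE-WAY matching):
if `S` is `δ`-separated and matched INTO `S'` within `η` on `B(0, R)` (`2η < δ`, `25η < a`), and
`S'` is radially admissible at scale `a` on `B(0, R + η)`, then a bond `(y, v)` of `S` deep inside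
the ball with at least `n` common bonded neighbours is matched to a bond `(y', v')` of `S'` with at
least `n` common bonded neighbours: lower bounds on common-neighbour counts are pushed forward by
the matching injection, the gap `(1.02a, 1.26a)` of `S'` absorbing the `2η` distortion.  Applied
from the limit `Y` into the approximants it makes `≤ 4` pass TO the limit; applied from the
approximants into `Y` it makes `≥ 4` pass to the limit. (To be proved by the line; the proof is
the injectivity half of the workfile's `gappedTwelve_transfer`.) -/
theorem commonNbrs_le_transfer {S S' : Set E3} {a δ η R : ℝ} (ha : 0 < a) (hδ : 0 < δ)
    (hη : 0 ≤ η) (h2η : 2 * η < δ) (hηa : 25 * η < a)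
    (hS : ∀ u ∈ S, ∀ w ∈ S, u ≠ w → δ ≤ dist u w)
    (hS' : ∀ u ∈ S', ∀ w ∈ S', u ≠ w → δ ≤ dist u w)
    (hm : ∀ q ∈ S, ‖q‖ ≤ R → ∃ p ∈ S', dist q p ≤ η)
    (hrad : ∀ p ∈ S', ‖p‖ ≤ R + η → ∀ w ∈ S', w ≠ p →
      a * (1 - 1 / 50) ≤ dist p w ∧ (dist p w ≤ a * (1 + 1 / 50) ∨ a * (63 / 50) ≤ dist p w))
    {y v : E3} (hy : y ∈ S) (hv : v ∈ S) (hvy : v ≠ y) (hdv : dist y v ≤ a * (1 + 1 / 50))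
    (hR : ‖y‖ + 3 * a ≤ R) {n : ℕ} (hn : n ≤ (CommonNbrs a S y v).ncard) :
    ∃ y' ∈ S', ∃ v' ∈ S', dist y y' ≤ η ∧ dist v v' ≤ η ∧ v' ≠ y' ∧
      dist y' v' ≤ a * (1 + 1 / 50) ∧ n ≤ (CommonNbrs a S' y' v').ncard := by
  classical
  -- distortion of distances under the matching
  have hdist : ∀ {p q p' q' : E3}, dist p p' ≤ η → dist q q' ≤ η →
      dist p' q' ≤ dist p q + 2 * η ∧ dist p q ≤ dist p' q' + 2 * η := by
    intro p q p' q' hp hq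
    have h := dist_dist_dist_le p' q' p q
    rw [Real.dist_eq, dist_comm p' p, dist_comm q' q] at h
    obtain ⟨h1, h2⟩ := abs_sub_le_iff.1 (h.trans (add_le_add hp hq))
    constructor <;> linarith
  -- partners of distinct points of `S` are distinct
  have hne_of : ∀ {p q p' q' : E3}, p ∈ S → q ∈ S → p ≠ q → dist p p' ≤ η → dist q q' ≤ η →
      p' ≠ q' := by
    intro p q p' q' hp hq hpq hpp' hqq' h
    have hsep := hS p hp q hq hpq
    have := (hdist hpp' hqq').2
    rw [h, dist_self] at this
    linarith
  -- the gap of `S'` absorbs the distortion: a near-bond of `S'` is a bond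
  have hbond : ∀ p' ∈ S', ‖p'‖ ≤ R + η → ∀ q' ∈ S', q' ≠ p' →
      dist p' q' ≤ a * (1 + 1 / 50) + 2 * η → dist p' q' ≤ a * (1 + 1 / 50) := by
    intro p' hp' hp'R q' hq' hne hle
    rcases (hrad p' hp' hp'R q' hq' hne).2 with h | h
    · exact h
    · exfalso; linarith
  -- norms of the players
  have hyR : ‖y‖ ≤ R := by linarith
  have hvR : ‖v‖ ≤ R := by
    have h1 := norm_sub_norm_le v y
    rw [← dist_eq_norm, dist_comm] at h1
    linarith
  obtain ⟨y', hy'S, hyy'⟩ := hm y hy hyR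
  obtain ⟨v', hv'S, hvv'⟩ := hm v hv hvR
  have hy'R : ‖y'‖ ≤ R + η := by
    have h1 := norm_sub_norm_le y' y
    rw [← dist_eq_norm, dist_comm] at h1
    linarith
  have hv'R : ‖v'‖ ≤ R + η := by
    have h1 := norm_sub_norm_le v' v
    rw [← dist_eq_norm, dist_comm] at h1
    linarith
  have hv'y' : v' ≠ y' := fun h => hne_of hy hv (Ne.symm hvy) hyy' hvv' h.symm
  have hdy'v' : dist y' v' ≤ a * (1 + 1 / 50) :=
    hbond y' hy'S hy'R v' hv'S hv'y' (by linarith [(hdist hyy' hvv').1])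
  -- every common neighbour of `(y, v)` has a partner that is a common neighbour of `(y', v')`
  have hpart : ∀ w ∈ CommonNbrs a S y v, ∃ w' ∈ CommonNbrs a S' y' v', dist w w' ≤ η := by
    rintro w ⟨hwS, hwy, hwv, hdyw, hdvw⟩
    have hwR : ‖w‖ ≤ R := by
      have h1 := norm_sub_norm_le w y
      rw [← dist_eq_norm, dist_comm] at h1
      linarith
    obtain ⟨w', hw'S, hww'⟩ := hm w hwS hwR
    have hw'y' : w' ≠ y' := fun h => hne_of hwS hy hwy hww' hyy' h
    have hw'v' : w' ≠ v' := fun h => hne_of hwS hv hwv hww' hvv' h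
    refine ⟨w', ⟨hw'S, hw'y', hw'v', ?_, ?_⟩, hww'⟩
    · exact hbond y' hy'S hy'R w' hw'S hw'y' (by linarith [(hdist hyy' hww').1])
    · exact hbond v' hv'S hv'R w' hw'S hw'v' (by linarith [(hdist hvv' hww').1])
  choose! g hg using hpart
  have hginj : Set.InjOn g (CommonNbrs a S y v) := by
    intro w₁ h₁ w₂ h₂ heq
    by_contra hne
    have hsep := hS w₁ h₁.1 w₂ h₂.1 hne
    have : dist w₁ w₂ ≤ 2 * η :=
      calc dist w₁ w₂ ≤ dist w₁ (g w₁) + dist w₂ (g w₁) := dist_triangle_right _ _ _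
        _ ≤ η + η := by
            gcongr
            · exact (hg w₁ h₁).2
            · rw [heq]; exact (hg w₂ h₂).2
        _ = 2 * η := by ring
    linarith
  -- the target is finite (separated subset of a ball)
  have hfin : (CommonNbrs a S' y' v').Finite := by
    refine finite_of_forall_le_dist_of_subset_closedBall hδ
      (fun u hu w hw huw => hS' u hu.1 w hw.1 huw) (c := y') (R := a * (1 + 1 / 50)) ?_
    intro w hw
    exact Metric.mem_closedBall.2 (by rw [dist_comm]; exact hw.2.2.2.1)
  exact ⟨y', hy'S, v', hv'S, hyy', hvv', hv'y', hdy'v',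
    hn.trans (Set.ncard_le_ncard_of_injOn g (fun w hw => (hg w hw).1) hginj hfin)⟩

/-- Card `semicontinuous-census`, the closedness it buys: EXACT FOUR-REGULARITY of all bonds at
a site is closed under local-rubber limits of `δ`-separated configurations that are
gapped-twelve and four-regular on growing balls, the limit being all-gapped-twelve (landed
`stub_cleGappedOfLimit` / workfile `gappedTwelve_of_tendsto`).  Proof = `commonNbrs_le_transfer`
TWICE: from the limit into a fine approximant (`≤ 4` comes back) and from that approximant into
the limit (`≥ 4` comes back), the partners being identified by separation. PROVED. -/
theorem fourRegular_of_tendsto {S : ℕ → LocalConfig E3} {Y : LocalConfig E3} {a δ : ℝ}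
    (ha : 0 < a) (hδ : 0 < δ) (hS : ∀ k, ∀ u ∈ S k, ∀ w ∈ S k, u ≠ w → δ ≤ dist u w)
    (hY : Tendsto S atTop (𝓝 Y)) {y : E3} (hy : y ∈ Y)
    (hgoodY : ∀ z ∈ (Y : Set E3), GappedTwelve a (Y : Set E3) z)
    (hgood : ∀ ρ : ℝ, ∀ᶠ k in atTop, ∀ p ∈ S k, ‖p‖ ≤ ρ → GappedTwelve a (S k : Set E3) p ∧
      ∀ q ∈ S k, q ≠ p → dist p q ≤ a * (1 + 1 / 50) → (CommonNbrs a (S k : Set E3) p q).ncard = 4) :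
    ∀ v ∈ (Y : Set E3), v ≠ y → dist y v ≤ a * (1 + 1 / 50) →
      (CommonNbrs a (Y : Set E3) y v).ncard = 4 := by
  intro v hv hvy hdv
  -- the limit is `δ`-separated (closed class)
  have hYsep : ∀ u ∈ Y, ∀ w ∈ Y, u ≠ w → δ ≤ dist u w :=
    (LocalConfig.isClosed_setOf_separated δ).mem_of_tendsto hY (Eventually.of_forall hS)
  -- a fine matching scale and a radius with room for both transfers
  set η : ℝ := min (δ / 4) (a / 50) with hη_def
  have hη : 0 < η := lt_min (by positivity) (by positivity)
  have hηδ : η ≤ δ / 4 := min_le_left _ _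
  have hηa : η ≤ a / 50 := min_le_right _ _
  set R : ℝ := ‖y‖ + 8 * a with hR_def
  obtain ⟨k, hmatch, hgk⟩ :=
    (((LocalConfig.tendsto_iff_locallyMatches.1 hY) R η hη).and (hgood (R + 1 + a))).exists
  have hradk : ∀ p ∈ (S k : Set E3), ‖p‖ ≤ R + η → ∀ w ∈ (S k : Set E3), w ≠ p →
      a * (1 - 1 / 50) ≤ dist p w ∧ (dist p w ≤ a * (1 + 1 / 50) ∨ a * (63 / 50) ≤ dist p w) :=
    fun p hp hpR w hw hwp => (hgk p hp (by linarith)).1.2 w hw hwp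
  have hradY : ∀ p ∈ (Y : Set E3), ‖p‖ ≤ R + η → ∀ w ∈ (Y : Set E3), w ≠ p →
      a * (1 - 1 / 50) ≤ dist p w ∧ (dist p w ≤ a * (1 + 1 / 50) ∨ a * (63 / 50) ≤ dist p w) :=
    fun p hp _ w hw hwp => (hgoodY p hp).2 w hw hwp
  -- transfer 1: from the limit into the approximant (`≤ 4` comes back)
  obtain ⟨p, hp, q, hq, hyp, hvq, hqp, hdpq, hle⟩ :=
    commonNbrs_le_transfer ha hδ hη.le (by linarith) (by linarith) hYsep (hS k) hmatch.2 hradk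
      hy hv hvy hdv (by rw [hR_def]; linarith) le_rfl
  have hpn : ‖p‖ ≤ ‖y‖ + η := by
    have h1 := norm_sub_norm_le p y
    rw [← dist_eq_norm, dist_comm] at h1
    linarith
  have h4k : (CommonNbrs a (S k : Set E3) p q).ncard = 4 :=
    (hgk p hp (by rw [hR_def] at *; linarith)).2 q hq hqp hdpq
  -- transfer 2: from the approximant into the limit (`≥ 4` comes back)
  have hm' : ∀ q ∈ (S k : Set E3), ‖q‖ ≤ R → ∃ p ∈ (Y : Set E3), dist q p ≤ η := by
    intro q hq hqR
    obtain ⟨p, hp, hd⟩ := hmatch.1 q hq hqR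
    exact ⟨p, hp, by rw [dist_comm]; exact hd⟩
  obtain ⟨y', hy', v', hv', hpy', hqv', -, -, hge⟩ :=
    commonNbrs_le_transfer ha hδ hη.le (by linarith) (by linarith) (hS k) hYsep hm' hradY
      hp hq hqp hdpq (by rw [hR_def] at *; linarith) h4k.ge
  -- the partners of the partners are the original sites (separation of the limit)
  have hyy' : y' = y := by
    by_contra hne
    have hsep := hYsep y' hy' y hy hne
    have : dist y' y ≤ 2 * η :=
      calc dist y' y ≤ dist y' p + dist y p := dist_triangle_right _ _ _
        _ ≤ η + η := by rw [dist_comm y' p]; gcongr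
        _ = 2 * η := by ring
    linarith
  have hvv' : v' = v := by
    by_contra hne
    have hsep := hYsep v' hv' v hv hne
    have : dist v' v ≤ 2 * η :=
      calc dist v' v ≤ dist v' q + dist v q := dist_triangle_right _ _ _
        _ ≤ η + η := by rw [dist_comm v' q]; gcongr
        _ = 2 * η := by ring
    linarith
  subst hyy' hvv'
  exact le_antisymm (hle.trans h4k.le) hge

/-- Card `semicontinuous-census`, last step IN THE FINAL CONFIGURATION (no limit involved):
all-gapped-twelve + exactly-four-regular everywhere ⇒ clean everywhere, by the trichotomy.
PROVED (it is `fccHcpShell_of_fourRegular` sitewise). -/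
theorem allClean_of_allFourRegular (hST : ShellTrichotomy) {Y : Set E3} {a : ℝ} (ha : 0 < a)
    (hgood : ∀ y ∈ Y, GappedTwelve a Y y)
    (h4 : ∀ y ∈ Y, ∀ v ∈ Y, v ≠ y → dist y v ≤ a * (1 + 1 / 50) → (CommonNbrs a Y y v).ncard = 4) :
    ∀ y ∈ Y, GappedTwelve a Y y ∧ FccHcpShell a Y y :=
  fun y hy => ⟨hgood y hy, fccHcpShell_of_fourRegular hST ha hgood hy (h4 y hy)⟩

end Summit.AtomisticToContinuum.Crystallization.Cruxes.CleanLimitExtractionR.Ideator1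

end
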